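import Mathlib
import Literature.Analysis.FluidPDE.IsometryInvariance
import Summits.NavierStokesRegularity.NavierStokesRegularity.Theorems.PlaneEnergyCeilingPlanarEnergyAPrioriWeightedIdentity
import Summits.NavierStokesRegularity.NavierStokesRegularity.Theorems.PlaneEnergyCeilingPlanarEnergyAPrioriFluxLedgerLH

/-!
# Route PlaneEnergyCeiling · crux `PlanarEnergyAPriori` — the flux ledger through every plane

Helper file for the crux item stmt-NavierStokesRegularity-16855 (`PlanarEnergyAPriori`, route
`PlaneEnergyCeiling`), landed `--supports` that item. The signed flux ledger
(`Theorems/…FluxLedger.lean`, unconditional since `weightedEnergyIdentity` landed) is stated for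
the coordinate planes `{x₂ = c}`; the open stub `stub_fluxConvergenceBudget` quantifies over ALL
planes `R({x₂ = c})`. This file transports the ledger to every direction by the rotation
covariance of the Navier–Stokes system (accepted `IsometryInvariance`:
`IsClassicalNSSolutionOn.conj_linearIsometryEquiv`): for a linear isometry `R` with unit normal
`n = R e₂`,

  `|∫_{(s₁,s₂)} ∫ g'(⟪x,n⟫) (|u|²/2 + (p − π₀(s))) ⟪u, n⟫ dx ds| ≤ E₀ (2 + ν K₂ (s₂ − s₁))`

(`fluxLedger_dir`), under the same hypotheses as the coordinate ledger (classical solution on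
`[0,t]`, order-(3,2) decay, energy class, `C²` weight `0 ≤ g ≤ 1` with `|g'| ≤ K₁`, `|g''| ≤ K₂`).
The conjugate pair `(R⁻¹ u(t, R·), p(t, R·))` is again a classical solution with the same decay
constants, the same energies and the same dissipation (Lebesgue measure and the Frobenius norm are
rotation invariant), and its coordinate flux is the flux of `u` through the planes normal to `n`.
Folklore.
-/

noncomputable section

-- single-conjunct summit: `Summit.<Summit>.<Problem>` repeats the name by the D-0017 layout
set_option linter.dupNamespace false

namespace Summit.NavierStokesRegularity.NavierStokesRegularity.Theorems.PlanarEnergyAPriori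

open MeasureTheory Set Filter Topology Function WithLp
open scoped ENNReal RealInnerProductSpace Laplacian
open Literature.Analysis.FluidPDE

variable {ν t : ℝ} {u : ℝ → EuclideanSpace ℝ (Fin 3) → EuclideanSpace ℝ (Fin 3)} {p : ℝ → EuclideanSpace ℝ (Fin 3) → ℝ}

/-- `Σⱼ ‖L (R eⱼ)‖² = Σⱼ ‖L eⱼ‖²`: the Frobenius norm over a rotated orthonormal frame. -/
theorem sum_norm_sq_apply_isometry_single (L : EuclideanSpace ℝ (Fin 3) →L[ℝ] EuclideanSpace ℝ (Fin 3))
    (R : EuclideanSpace ℝ (Fin 3) ≃ₗᵢ[ℝ] EuclideanSpace ℝ (Fin 3)) :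
    ∑ j : Fin 3, ‖L (R (EuclideanSpace.single j 1))‖ ^ 2 = ∑ j : Fin 3, ‖L (EuclideanSpace.single j 1)‖ ^ 2 := by
  rw [sum_norm_sq_apply_single_eq_frobeniusNormSq, frobeniusNormSq_eq_sum ((EuclideanSpace.basisFun (Fin 3) ℝ).map R)]
  simp

/-- Change of variables under a linear isometry of `ℝ³`: `∫ f (R x) dx = ∫ f x dx`. -/
theorem integral_comp_isometry {F : Type*} [NormedAddCommGroup F] [NormedSpace ℝ F]
    (R : EuclideanSpace ℝ (Fin 3) ≃ₗᵢ[ℝ] EuclideanSpace ℝ (Fin 3)) (f : EuclideanSpace ℝ (Fin 3) → F) :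
    ∫ x, f (R x) = ∫ x, f x :=
  R.measurePreserving.integral_comp R.toContinuousLinearEquiv.toHomeomorph.measurableEmbedding f

/-- **THE FLUX LEDGER THROUGH EVERY PLANE.** Let `(u,p)` be a classical solution of unforced
Navier–Stokes on `ℝ³ × [0,t]` (`ν > 0`, `t > 0`) with order-(3,2) decay on `[0,t]` (pressure
normalised by `π₀(s)`), energies `∫|u(s)|² ≤ 2E₀` and dissipation `ν∫₀ᵗ∫Σⱼ‖∂ⱼu‖² ≤ E₀`. Then for
every linear isometry `R` (unit normal `n = R e₂`), every `C²` weight `g` with `0 ≤ g ≤ 1`,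
`|g'| ≤ K₁`, `|g''| ≤ K₂`, and all `0 ≤ s₁ ≤ s₂ ≤ t`:
`|∫_{(s₁,s₂)} ∫ g'(⟪x,n⟫)(|u|²/2 + (p − π₀(s)))⟪u,n⟫ dx ds| ≤ E₀ (2 + ν K₂ (s₂ − s₁))`. [folklore] -/
theorem fluxLedger_dir (hν : 0 < ν) (ht : 0 < t) (hcl : IsClassicalNSSolutionOn (Icc 0 t) ν 0 u p)
    {C : ℝ} {π₀ : ℝ → ℝ}
    (h0 : ∀ s ∈ Icc 0 t, ∀ x, ‖u s x‖ ≤ C * (1 + ‖x‖) ^ (-(3 : ℝ)))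
    (h1 : ∀ s ∈ Icc 0 t, ∀ x, ‖fderiv ℝ (u s) x‖ ≤ C * (1 + ‖x‖) ^ (-(3 : ℝ)))
    (h2 : ∀ s ∈ Icc 0 t, ∀ x, ‖iteratedFDeriv ℝ 2 (u s) x‖ ≤ C * (1 + ‖x‖) ^ (-(3 : ℝ)))
    (k0 : ∀ s ∈ Icc 0 t, ∀ x, |p s x - π₀ s| ≤ C * (1 + ‖x‖) ^ (-(2 : ℝ)))
    (k1 : ∀ s ∈ Icc 0 t, ∀ x, ‖gradient (p s) x‖ ≤ C * (1 + ‖x‖) ^ (-(2 : ℝ)))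
    {E₀ : ℝ} (hE : ∀ s ∈ Icc 0 t, ∫ x, ‖u s x‖ ^ 2 ≤ 2 * E₀)
    (hDiss : ν * ∫ s in Ioo 0 t, ∫ x, ∑ j : Fin 3, ‖fderiv ℝ (u s) x (EuclideanSpace.single j 1)‖ ^ 2 ≤ E₀)
    {g : ℝ → ℝ} (hg : ContDiff ℝ 2 g) {K₁ K₂ : ℝ} (hg01 : ∀ z, 0 ≤ g z ∧ g z ≤ 1)
    (hK₁ : ∀ z, |deriv g z| ≤ K₁) (hK₂ : ∀ z, |deriv (deriv g) z| ≤ K₂)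
    (R : EuclideanSpace ℝ (Fin 3) ≃ₗᵢ[ℝ] EuclideanSpace ℝ (Fin 3))
    {s₁ s₂ : ℝ} (hs₁ : 0 ≤ s₁) (hs : s₁ ≤ s₂) (hs₂ : s₂ ≤ t) :
    |∫ s in Ioo s₁ s₂, ∫ x, deriv g ⟪x, R (EuclideanSpace.single 2 1)⟫ *
        ((‖u s x‖ ^ 2 / 2 + (p s x - π₀ s)) * ⟪u s x, R (EuclideanSpace.single 2 1)⟫)| ≤
      E₀ * (2 + ν * K₂ * (s₂ - s₁)) := by
  have hU : UniqueDiffOn ℝ (Icc 0 t) := uniqueDiffOn_Icc ht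
  -- the conjugate pair
  set v : ℝ → EuclideanSpace ℝ (Fin 3) → EuclideanSpace ℝ (Fin 3) := fun s x => R.symm (u s (R.symm.symm x)) with hv
  set q : ℝ → EuclideanSpace ℝ (Fin 3) → ℝ := fun s x => p s (R.symm.symm x) with hq
  have hvu : ∀ s x, v s x = R.symm (u s (R x)) := fun s x => by simp [hv]
  have hqp : ∀ s x, q s x = p s (R x) := fun s x => by simp [hq]
  have hcl' : IsClassicalNSSolutionOn (Icc 0 t) ν 0 v q := by
    have h := hcl.conj_linearIsometryEquiv (R := R.symm) hU
    refine h.congr_force fun s _ x => ?_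
    simp
  -- decay of the conjugate pair
  have h0' : ∀ s ∈ Icc 0 t, ∀ x, ‖v s x‖ ≤ C * (1 + ‖x‖) ^ (-(3 : ℝ)) := fun s hs' x => by
    rw [hvu, LinearIsometryEquiv.norm_map]; simpa [LinearIsometryEquiv.norm_map] using h0 s hs' (R x)
  have h1' : ∀ s ∈ Icc 0 t, ∀ x, ‖fderiv ℝ (v s) x‖ ≤ C * (1 + ‖x‖) ^ (-(3 : ℝ)) := fun s hs' x => by
    have : v s = fun y => R.symm (u s (R.symm.symm y)) := rfl
    rw [this, fderiv_conj_linearIsometryEquiv, ContinuousLinearMap.opNorm_linearIsometryEquiv_comp,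
      ContinuousLinearMap.opNorm_comp_linearIsometryEquiv]
    simpa [LinearIsometryEquiv.norm_map] using h1 s hs' (R x)
  have h2' : ∀ s ∈ Icc 0 t, ∀ x, ‖iteratedFDeriv ℝ 2 (v s) x‖ ≤ C * (1 + ‖x‖) ^ (-(3 : ℝ)) := fun s hs' x => by
    have : v s = R.symm ∘ (u s ∘ R.symm.symm) := rfl
    rw [this, LinearIsometryEquiv.norm_iteratedFDeriv_comp_left, LinearIsometryEquiv.norm_iteratedFDeriv_comp_right]
    simpa [LinearIsometryEquiv.norm_map] using h2 s hs' (R x)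
  have k0' : ∀ s ∈ Icc 0 t, ∀ x, |q s x - π₀ s| ≤ C * (1 + ‖x‖) ^ (-(2 : ℝ)) := fun s hs' x => by
    rw [hqp]; simpa [LinearIsometryEquiv.norm_map] using k0 s hs' (R x)
  have k1' : ∀ s ∈ Icc 0 t, ∀ x, ‖gradient (q s) x‖ ≤ C * (1 + ‖x‖) ^ (-(2 : ℝ)) := fun s hs' x => by
    have : q s = fun y => p s (R.symm.symm y) := rfl
    rw [this, gradient_comp_linearIsometryEquiv_symm, LinearIsometryEquiv.norm_map]
    simpa [LinearIsometryEquiv.norm_map] using k1 s hs' (R x)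
  -- energies and dissipation of the conjugate pair
  have hE' : ∀ s ∈ Icc 0 t, ∫ x, ‖v s x‖ ^ 2 ≤ 2 * E₀ := fun s hs' => by
    have : (fun x => ‖v s x‖ ^ 2) = fun x => (fun y => ‖u s y‖ ^ 2) (R x) := by
      funext x; rw [hvu, LinearIsometryEquiv.norm_map]
    rw [this, integral_comp_isometry R (fun y => ‖u s y‖ ^ 2)]
    exact hE s hs'
  have hDiss' : ν * ∫ s in Ioo 0 t, ∫ x, ∑ j : Fin 3, ‖fderiv ℝ (v s) x (EuclideanSpace.single j 1)‖ ^ 2 ≤ E₀ := by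
    have hpt : ∀ s x, ∑ j : Fin 3, ‖fderiv ℝ (v s) x (EuclideanSpace.single j 1)‖ ^ 2 =
        ∑ j : Fin 3, ‖fderiv ℝ (u s) (R x) (EuclideanSpace.single j 1)‖ ^ 2 := by
      intro s x
      have hvs : v s = fun y => R.symm (u s (R.symm.symm y)) := rfl
      have hfd := fderiv_conj_linearIsometryEquiv (R := R.symm) (u s) x
      rw [← hvs] at hfd
      have hj : ∀ j : Fin 3, ‖fderiv ℝ (v s) x (EuclideanSpace.single j 1)‖ =
          ‖fderiv ℝ (u s) (R x) (R (EuclideanSpace.single j 1))‖ := fun j => by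
        rw [hfd]; simp
      simp_rw [hj]
      exact sum_norm_sq_apply_isometry_single (fderiv ℝ (u s) (R x)) R
    have hslice : ∀ s, ∫ x, ∑ j : Fin 3, ‖fderiv ℝ (v s) x (EuclideanSpace.single j 1)‖ ^ 2 =
        ∫ x, ∑ j : Fin 3, ‖fderiv ℝ (u s) x (EuclideanSpace.single j 1)‖ ^ 2 := fun s => by
      rw [show (fun x => ∑ j : Fin 3, ‖fderiv ℝ (v s) x (EuclideanSpace.single j 1)‖ ^ 2) =
        fun x => (fun y => ∑ j : Fin 3, ‖fderiv ℝ (u s) y (EuclideanSpace.single j 1)‖ ^ 2) (R x) from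
        funext (hpt s)]
      exact integral_comp_isometry R (fun y => ∑ j : Fin 3, ‖fderiv ℝ (u s) y (EuclideanSpace.single j 1)‖ ^ 2)
    have heq : ∫ s in Ioo 0 t, ∫ x, ∑ j : Fin 3, ‖fderiv ℝ (v s) x (EuclideanSpace.single j 1)‖ ^ 2 =
        ∫ s in Ioo 0 t, ∫ x, ∑ j : Fin 3, ‖fderiv ℝ (u s) x (EuclideanSpace.single j 1)‖ ^ 2 :=
      integral_congr_ae (ae_of_all _ fun s => hslice s)
    rw [heq]; exact hDiss
  -- the coordinate ledger for the conjugate pair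
  have key := fluxLedger_of_weightedEnergyIdentity weightedEnergyIdentity hν ht hcl' h0' h1' h2' k0' k1' hE' hDiss'
    hg hg01 hK₁ hK₂ hs₁ hs hs₂
  -- identify the coordinate flux of `(v,q)` with the flux of `(u,p)` through the planes normal to `R e₂`
  have hflux : ∀ s, ∫ x, deriv g (x 2) * ((‖v s x‖ ^ 2 / 2 + (q s x - π₀ s)) * v s x 2) =
      ∫ x, deriv g ⟪x, R (EuclideanSpace.single 2 1)⟫ *
        ((‖u s x‖ ^ 2 / 2 + (p s x - π₀ s)) * ⟪u s x, R (EuclideanSpace.single 2 1)⟫) := by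
    intro s
    rw [← integral_comp_isometry R (fun x => deriv g ⟪x, R (EuclideanSpace.single 2 1)⟫ *
      ((‖u s x‖ ^ 2 / 2 + (p s x - π₀ s)) * ⟪u s x, R (EuclideanSpace.single 2 1)⟫))]
    refine integral_congr_ae (ae_of_all _ fun x => ?_)
    dsimp only
    rw [hvu, hqp, LinearIsometryEquiv.norm_map, LinearIsometryEquiv.inner_map_map]
    have hx2 : x 2 = ⟪x, EuclideanSpace.single 2 1⟫ := by simp [EuclideanSpace.inner_single_right]
    have hv2 : (R.symm (u s (R x))) 2 = ⟪u s (R x), R (EuclideanSpace.single 2 1)⟫ := by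
      have : (R.symm (u s (R x))) 2 = ⟪R.symm (u s (R x)), EuclideanSpace.single 2 1⟫ := by
        simp [EuclideanSpace.inner_single_right]
      rw [this]
      conv_lhs => rw [← LinearIsometryEquiv.inner_map_map R, LinearIsometryEquiv.apply_symm_apply]
    rw [hx2, hv2]
  have hint : ∫ s in Ioo s₁ s₂, ∫ x, deriv g (x 2) * ((‖v s x‖ ^ 2 / 2 + (q s x - π₀ s)) * v s x 2) =
      ∫ s in Ioo s₁ s₂, ∫ x, deriv g ⟪x, R (EuclideanSpace.single 2 1)⟫ *
        ((‖u s x‖ ^ 2 / 2 + (p s x - π₀ s)) * ⟪u s x, R (EuclideanSpace.single 2 1)⟫) :=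
    integral_congr_ae (ae_of_all _ fun s => hflux s)
  rw [← hint]
  exact key

/-- **The flux ledger through every plane, registered closed form** (sub-goal
`fluxLedger_dir_closedForm` of stmt-NavierStokesRegularity-16855). [folklore] -/
theorem fluxLedger_dir_closedForm : ∀ (ν t : ℝ), 0 < ν → 0 < t → ∀ (u : ℝ → EuclideanSpace ℝ (Fin 3) → EuclideanSpace ℝ (Fin 3)) (p : ℝ → EuclideanSpace ℝ (Fin 3) → ℝ), Literature.Analysis.FluidPDE.IsClassicalNSSolutionOn (Set.Icc 0 t) ν 0 u p → ∀ (C : ℝ) (π₀ : ℝ → ℝ), (∀ s ∈ Set.Icc 0 t, ∀ x, ‖u s x‖ ≤ C * (1 + ‖x‖) ^ (-(3 : ℝ))) → (∀ s ∈ Set.Icc 0 t, ∀ x, ‖fderiv ℝ (u s) x‖ ≤ C * (1 + ‖x‖) ^ (-(3 : ℝ))) → (∀ s ∈ Set.Icc 0 t, ∀ x, ‖iteratedFDeriv ℝ 2 (u s) x‖ ≤ C * (1 + ‖x‖) ^ (-(3 : ℝ))) → (∀ s ∈ Set.Icc 0 t, ∀ x, |p s x - π₀ s| ≤ C * (1 +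 ‖x‖) ^ (-(2 : ℝ))) → (∀ s ∈ Set.Icc 0 t, ∀ x, ‖gradient (p s) x‖ ≤ C * (1 + ‖x‖) ^ (-(2 : ℝ))) → ∀ (E₀ : ℝ), (∀ s ∈ Set.Icc 0 t, ∫ x, ‖u s x‖ ^ 2 ≤ 2 * E₀) → ν * (∫ s in Set.Ioo 0 t, ∫ x, ∑ j : Fin 3, ‖fderiv ℝ (u s) x (EuclideanSpace.single j 1)‖ ^ 2) ≤ E₀ → ∀ (g : ℝ → ℝ) (K₁ K₂ : ℝ), ContDiff ℝ 2 g → (∀ z, 0 ≤ g z ∧ g z ≤ 1) → (∀ z, |deriv g z| ≤ K₁) → (∀ z, |deriv (deriv g) z| ≤ K₂) → ∀ (R : EuclideanSpace ℝ (Fin 3) ≃ₗᵢ[ℝ] EuclideanSpace ℝ (Fin 3)) (s₁ s₂ : ℝ), 0 ≤ s₁ → s₁ ≤ s₂ → s₂ ≤ t → |∫ s in Set.Ioo s₁ s₂, ∫ x, deriv g (inner ℝ x (R (EuclideanSpace.single 2 1))) * ((‖u s x‖ ^ 2 / 2 + (p s x - π₀ s)) * inner ℝ (u s x) (R (EuclideanSpace.single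 2 1)))| ≤ E₀ * (2 + ν * K₂ * (s₂ - s₁)) :=
  fun _ _ hν ht _ _ hcl _ _ h0 h1 h2 k0 k1 _ hE hDiss _ _ _ hg hg01 hK₁ hK₂ R _ _ hs₁ hs hs₂ =>
    fluxLedger_dir hν ht hcl h0 h1 h2 k0 k1 hE hDiss hg hg01 hK₁ hK₂ R hs₁ hs hs₂

end Summit.NavierStokesRegularity.NavierStokesRegularity.Theorems.PlanarEnergyAPriori

end
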